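import Summits.QuantumFields.YangMills.Theorems.UnitScaleTiltHistoryTailIntData
import HarnessLib

/-!
# `UnitScaleTiltHistoryTailIntEnvelope` — crux `HistoryTailL` (stmt-QuantumFields-19936), R-57χ successor line: the UPPER a.e. row (41)′ and `EnvelopeRegular` for the interior datum
# `AlphaInputsT3AC.dataIntV3 qf π` of a family of data cores, FROM THE CORE'S FIELDS ALONE (`AlphaInputsT3ACv3Data` §3–§4 / `AlphaInputsT3ACv3` §3–§4, ★alpha-1 g3, with
# `h.pkgAtV3 hc γ hγ hγ1 K ↦ q K`; the (41) chain `PinnedStep.ineq41_pinned_windowed_ae_of_expo` + `AlphaV3AC.expo5558_le_expo41_succ_of_alphaV3Core` + `resDensity = e^{E}ρ` a.e. is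
# inlined so that nothing but `PkgCoreV3`'s fields is read) — seat ym3-torus-p2 (g16)

`dataIntV3_ineq41AE` (every `j ≤ K`), `dataIntV3_integrable_up`, `dataIntV3_integrable_low` (measurable interior indicator), `dataIntV3_integral_low_pos` (positive Haar mass of the
interior window), `dataIntV3_envelopeRegular`.  The LOWER a.e. row (47)′ is NOT here: it is the χ-package's input (`…LaneTailChi`).  Nothing of [Balaban1985UV3] is asserted;
CONDITIONAL only on the family `q`.

References: T. Bałaban, Commun. Math. Phys. 102 (1985) 255–275 [Balaban1985UV3] ((1)–(2) p.256, (41) p.266, (47) p.267, (55) p.269, Thm 2 p.272).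
-/

set_option autoImplicit false

noncomputable section

namespace Summit.QuantumFields.YangMills.Theorems

open MeasureTheory
open scoped BigOperators
open Literature.MathematicalPhysics.QuantumFieldTheory.Balaban1983to89
open Literature.MathematicalPhysics.QuantumFieldTheory.Balaban1983to89.T3ContinuumYM3Torus
open Literature.MathematicalPhysics.QuantumFieldTheory.Balaban1983to89.T3UnitLawDensityEML (ℰp)
open Literature.MathematicalPhysics.QuantumFieldTheory.Balaban1983to89.T3UnitScaleTilt (θBal)
open Literature.MathematicalPhysics.QuantumFieldTheory.Balaban1983to89.T3AlphaInputsAC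
open Literature.MathematicalPhysics.QuantumFieldTheory.Balaban1985CMP102
open Literature.MathematicalPhysics.QuantumFieldTheory.Balaban1985CMP102.Setting
open Summit.QuantumFields.Balaban3D.Carriers
open Summit.QuantumFields.Balaban3D.Proofs.Primitives
open Summit.QuantumFields.Balaban3D.Proofs.TowerAC
open Summit.QuantumFields.Balaban3D.Proofs.StandardAC
open Summit.QuantumFields.Balaban3D.Proofs.InputsAC
open Summit.QuantumFields.Balaban3D.Proofs.TowerFactsAC
open Summit.QuantumFields.Balaban3D.Proofs.TransportAC (integrable_mul_exp_of_le)
open Summit.QuantumFields.Balaban3D.Proofs (Bound55Std.measurable_actionEta Bound55Std.actionEta_nonneg)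

variable {F : T3Family} {𝔠 : AlphaConsts F.L (suGroupModel 2).N} {γ : ℝ} {hγ : 0 < γ} {hγ1 : γ ≤ (min 𝔠.gamma0 1) ^ 2}
  (q : ∀ K, AlphaInputsT3AC.PkgCoreV3 F 𝔠 γ hγ hγ1 K) (π : AlphaInputsT3AC.PolymerT3 F)

/-! ## §1 The upper sandwich (41)′ a.e. from the core rows -/

/-- **(41)′ a.e., every `j ≤ K`, WITH THE WINDOWED PINNED HISTORY SUM, FROM THE CORE ROWS ALONE** (`PkgAtV3.resDensity_le_sum_ae`'s proof read off the core's FIELDS: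
`PinnedStep.ineq41_pinned_windowed_ae_of_expo` fed by the projected rows `fibre55Win`, the exponent step `AlphaV3AC.expo5558_le_expo41_succ_of_alphaV3Core` (seven χ-free
leaves), the data rows, and `resDensity = e^{E}ρ_j` a.e. (`rho_towerOfAC_ae_eq_towerDensity`)). [cite: Balaban1985UV3, (41) p.266, (55) p.269 and Thm 2 p.272] -/
theorem AlphaInputsT3AC.dataIntV3_ineq41AE (K j : ℕ) (hj : j ≤ K) : Ineq41AE (AlphaInputsT3AC.dataIntV3 q π) K j := by
  -- (41) for the core's tower with the windowed pinned weights, `dV`-a.e.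
  have h41 : ∀ᵐ V ∂fieldMeasure (F.P K) j (Matrix.specialUnitaryGroup (Fin 2) ℂ), (q K).T.ρ j V ≤
      ∑ h : Hist (F.P K) j, (q K).wtP j h V *
        Real.exp (-((q K).T.mainT j h V) + (q K).T.Pint j h V - (q K).T.Ecst j + (q K).T.Zterm j h + (q K).T.Rm j) :=
    PinnedStep.ineq41_pinned_windowed_ae_of_expo 𝔠.lane (q K).X (q K).𝔖 (AlphaInputsT3AC.admWindowT3 F 𝔠 γ hγ hγ1 K)
      (AlphaInputsT3AC.measurableSet_admWindowT3 F 𝔠 γ hγ hγ1 K) (fun k hk h' => ((q K).runCore.steps k hk).fibre55Win h')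
      (fun k hk hh U => AlphaV3AC.expo5558_le_expo41_succ_of_alphaV3Core (T3Scales_window F 𝔠 γ hγ hγ1 K) (q K).runCore k hk hh U)
      (fun k hk => ((q K).runCore.steps k hk).hU) (fun k hk => ((q K).runCore.steps k hk).hPm)
      (fun k hk => ⟨(q K).𝔄.cP k, ((q K).runCore.steps k hk).hPb⟩) j hj
  -- `resDensity = e^{E}·ρ_j` a.e.
  have hρ₀ : ∀ U, 0 ≤ Real.exp (-(q K).E) * Missing.boltzmann (F.P K) ((F.scheme ℰp γ).β K) U := fun U =>
    mul_nonneg (Real.exp_nonneg _) (Missing.boltzmann_pos (G := Matrix.specialUnitaryGroup (Fin 2) ℂ) (F.P K) _ U).le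
  have hint : Integrable (fun U => Real.exp (-(q K).E) * Missing.boltzmann (F.P K) ((F.scheme ℰp γ).β K) U)
      (fieldMeasure (F.P K) 0 (Matrix.specialUnitaryGroup (Fin 2) ℂ)) := by
    have h := integrable_wilsonStart (P := (T3Scales F γ hγ (hγ1.trans (sq_min_one_le _ 𝔠.gamma0_pos)) K).P)
      (G := Matrix.specialUnitaryGroup (Fin 2) ℂ) (g0sq_nonneg (T3Scales F γ hγ (hγ1.trans (sq_min_one_le _ 𝔠.gamma0_pos)) K)) (q K).E
    rw [wilsonStart_T3_eq] at h
    exact h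
  have hstart : Set.univ.indicator (Missing.boltzmann (G := Matrix.specialUnitaryGroup (Fin 2) ℂ) (F.P K) ((F.scheme ℰp γ).β K)) =
      fun U => Real.exp (q K).E * (Real.exp (-(q K).E) * Missing.boltzmann (F.P K) ((F.scheme ℰp γ).β K) U) := by
    funext U
    rw [Set.indicator_univ, ← mul_assoc, ← Real.exp_add, add_neg_cancel, Real.exp_zero, one_mul]
  have h1 := towerDensity_const_mul_ae F K _ hρ₀ hint (Real.exp_nonneg (q K).E) j (by omega)
  have h2 : (q K).T.ρ j =ᵐ[fieldMeasure (F.P K) j (Matrix.specialUnitaryGroup (Fin 2) ℂ)]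
      T3RestrictedUnitDensity.towerDensity F K (fun U => Real.exp (-(q K).E) * Missing.boltzmann (F.P K) ((F.scheme ℰp γ).β K) U) j :=
    rho_towerOfAC_ae_eq_towerDensity 𝔠.lane (q K).X rfl (q K).𝔖 j (by omega)
  have hR : T3RestrictedUnitDensity.resDensity F γ K Set.univ j =ᵐ[fieldMeasure (F.P K) j (Matrix.specialUnitaryGroup (Fin 2) ℂ)]
      fun V => Real.exp (q K).E * (q K).T.ρ j V := by
    show T3RestrictedUnitDensity.towerDensity F K (Set.univ.indicator (Missing.boltzmann (F.P K) ((F.scheme ℰp γ).β K))) j =ᵐ[_] _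
    rw [hstart]
    filter_upwards [h1, h2] with V hV1 hV2
    rw [hV1, hV2]
  -- combine
  have hE : Real.exp (-((q K).T.Ecst j - (q K).E) + (q K).T.Rm j) = Real.exp (q K).E * Real.exp (-((q K).T.Ecst j) + (q K).T.Rm j) := by
    rw [← Real.exp_add]; congr 1; ring
  have hsplit : ∀ (a b c d r : ℝ), Real.exp (-a + b - c + d + r) = Real.exp (-c + r) * Real.exp (-a + b + d) := fun a b c d r => by
    rw [← Real.exp_add]; congr 1; ring
  show ∀ᵐ W ∂fieldMeasure (F.P K) j (Matrix.specialUnitaryGroup (Fin 2) ℂ),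
    T3RestrictedUnitDensity.resDensity F γ K Set.univ j W ≤ Real.exp (-((q K).T.Ecst j - (q K).E) + (q K).T.Rm j) *
      ∑ h : Hist (F.P K) j, (q K).wtP j h W * Real.exp (-((q K).T.mainT j h W) + (q K).T.Pint j h W + (q K).T.Zterm j h)
  filter_upwards [h41, hR] with W hW hRW
  rw [hRW, hE, mul_assoc]
  refine mul_le_mul_of_nonneg_left ?_ (Real.exp_pos _).le
  simp only [hsplit] at hW
  refine hW.trans (le_of_eq ?_)
  rw [Finset.mul_sum]
  exact Finset.sum_congr rfl fun r _ => by rw [mul_left_comm]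


/-! ## §2 `EnvelopeRegular` at every `j ≤ K` -/

/-- **`up_j` integrable, every `j ≤ K`** (the windowed pinned weights are integrable with `∫ ≤ 1`; data rows at level `j`). [cite: Balaban1985UV3, (41) p.266] -/
theorem AlphaInputsT3AC.dataIntV3_integrable_up (K j : ℕ) (hj : j ≤ K) :
    Integrable ((AlphaInputsT3AC.dataIntV3 q π).up K j) (fieldMeasure (F.P K) j (Matrix.specialUnitaryGroup (Fin 2) ℂ)) := by
  have hmain : ∀ (hh : Hist (F.P K) j) (W : GaugeField (F.P K) j (Matrix.specialUnitaryGroup (Fin 2) ℂ)), (q K).T.mainT j hh W =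
      ((T3Scales F γ hγ (hγ1.trans (sq_min_one_le _ 𝔠.gamma0_pos)) K).gk j)⁻¹ ^ 2 *
        (T3Scales F γ hγ (hγ1.trans (sq_min_one_le _ 𝔠.gamma0_pos)) K).actionEta j ((q K).UkH j hh W) := fun _ _ => rfl
  have hfun : (AlphaInputsT3AC.dataIntV3 q π).up K j = fun W => ∑ r : Hist (F.P K) j, (q K).wtP j r W *
      Real.exp (-((q K).T.mainT j r W) + (q K).T.Pint j r W + (q K).T.Zterm j r) :=
    funext fun W => AlphaInputsT3AC.dataIntV3_up_eq q π K j W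
  rw [hfun]
  refine integrable_finsetSum _ fun hh _ => ?_
  obtain ⟨hU, hPm, hPb⟩ := AlphaInputsT3AC.dataIntV3_dataRows q K j hj hh
  refine integrable_mul_exp_of_le (PinnedStep.integrable_wtP_and_integral_le 𝔠.lane (q K).X
    (AlphaInputsT3AC.admWindowT3 F 𝔠 γ hγ hγ1 K) (AlphaInputsT3AC.measurableSet_admWindowT3 F 𝔠 γ hγ hγ1 K) j hh).1 ?_
    (c := (q K).𝔄.cP j + (q K).T.Zterm j hh) ?_
  · simp_rw [hmain]
    exact ((measurable_const.mul ((Bound55Std.measurable_actionEta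
      (S := T3Scales F γ hγ (hγ1.trans (sq_min_one_le _ 𝔠.gamma0_pos)) K) j).comp hU)).neg.add hPm).add measurable_const
  · intro W
    have h0 : 0 ≤ (q K).T.mainT j hh W := by
      rw [hmain]
      exact mul_nonneg (sq_nonneg _) (Bound55Std.actionEta_nonneg (S := T3Scales F γ hγ (hγ1.trans (sq_min_one_le _ 𝔠.gamma0_pos)) K) j _)
    have h1 : (q K).T.Pint j hh W ≤ (q K).𝔄.cP j := hPb W
    linarith

/-- **`low_j` integrable, every `j ≤ K`** (`dataT3v3_integrable_low`'s proof with the measurable interior indicator in place of `chiSmall`). [cite: Balaban1985UV3, (47) p.267] -/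
theorem AlphaInputsT3AC.dataIntV3_integrable_low (K j : ℕ) (hj : j ≤ K) :
    Integrable ((AlphaInputsT3AC.dataIntV3 q π).low K j) (fieldMeasure (F.P K) j (Matrix.specialUnitaryGroup (Fin 2) ℂ)) := by
  have hmain : ∀ W : GaugeField (F.P K) j (Matrix.specialUnitaryGroup (Fin 2) ℂ), (q K).T.mainT j (Hist.triv (F.P K) j) W =
      ((T3Scales F γ hγ (hγ1.trans (sq_min_one_le _ 𝔠.gamma0_pos)) K).gk j)⁻¹ ^ 2 *
        (T3Scales F γ hγ (hγ1.trans (sq_min_one_le _ 𝔠.gamma0_pos)) K).actionEta j ((q K).UkH j (Hist.triv (F.P K) j) W) :=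
    fun _ => rfl
  have hS : MeasurableSet {V : GaugeField (F.P K) j (Matrix.specialUnitaryGroup (Fin 2) ℂ) |
      PlaqSmall (θBal F.L γ 𝔠.b₀ 𝔠.p₀ (K - j) / max 𝔠.B₃ 1) V} := T3UnitScaleTilt.measurableSet_plaqSmall _
  obtain ⟨hU, hPm, hPb⟩ := AlphaInputsT3AC.dataIntV3_dataRows q K j hj (Hist.triv (F.P K) j)
  rw [show (AlphaInputsT3AC.dataIntV3 q π).low K j = fun W =>
      {V : GaugeField (F.P K) j (Matrix.specialUnitaryGroup (Fin 2) ℂ) |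
          PlaqSmall (θBal F.L γ 𝔠.b₀ 𝔠.p₀ (K - j) / max 𝔠.B₃ 1) V}.indicator (fun _ => (1 : ℝ)) W *
        Real.exp (-((q K).T.mainT j (Hist.triv (F.P K) j) W) + (q K).T.Pint j (Hist.triv (F.P K) j) W)
    from funext fun W => AlphaInputsT3AC.dataIntV3_low_eq q π K j W]
  refine Balaban3D.Proofs.Transport48.integrable_weight_mul_exp ?_ ?_ ?_ ?_ (c := (q K).𝔄.cP j) ?_
  · exact measurable_const.indicator hS
  · intro W; by_cases hW : W ∈ {V : GaugeField (F.P K) j (Matrix.specialUnitaryGroup (Fin 2) ℂ) |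
        PlaqSmall (θBal F.L γ 𝔠.b₀ 𝔠.p₀ (K - j) / max 𝔠.B₃ 1) V}
    · rw [Set.indicator_of_mem hW]; norm_num
    · rw [Set.indicator_of_notMem hW]
  · intro W; by_cases hW : W ∈ {V : GaugeField (F.P K) j (Matrix.specialUnitaryGroup (Fin 2) ℂ) |
        PlaqSmall (θBal F.L γ 𝔠.b₀ 𝔠.p₀ (K - j) / max 𝔠.B₃ 1) V}
    · rw [Set.indicator_of_mem hW]
    · rw [Set.indicator_of_notMem hW]; norm_num
  · simp_rw [hmain]
    exact (measurable_const.mul ((Bound55Std.measurable_actionEta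
      (S := T3Scales F γ hγ (hγ1.trans (sq_min_one_le _ 𝔠.gamma0_pos)) K) j).comp hU)).neg.add hPm
  · intro W
    have h0 : 0 ≤ (q K).T.mainT j (Hist.triv (F.P K) j) W := by
      rw [hmain]
      exact mul_nonneg (sq_nonneg _) (Bound55Std.actionEta_nonneg (S := T3Scales F γ hγ (hγ1.trans (sq_min_one_le _ 𝔠.gamma0_pos)) K) j _)
    have h1 : (q K).T.Pint j (Hist.triv (F.P K) j) W ≤ (q K).𝔄.cP j := hPb W
    linarith

/-- **`0 < ∫ low_j`, every `j ≤ K`** (positive Haar mass of the interior window). [cite: Balaban1985UV3, (47) p.267] -/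
theorem AlphaInputsT3AC.dataIntV3_integral_low_pos (K j : ℕ) (hj : j ≤ K) :
    0 < ∫ W, (AlphaInputsT3AC.dataIntV3 q π).low K j W ∂fieldMeasure (F.P K) j (Matrix.specialUnitaryGroup (Fin 2) ℂ) := by
  have hχ := AlphaInputsT3AC.dataIntV3_chiRange q π
  rw [integral_pos_iff_support_of_nonneg_ae (ae_of_all _ fun W => low_nonneg hχ K j W) (AlphaInputsT3AC.dataIntV3_integrable_low q π K j hj)]
  have hθ := (AlphaInputsT3AC.dataIntV3_intRadius_pos_le q K j hj).1
  refine lt_of_lt_of_le (fieldMeasure_plaqSmall_pos (P := F.P K) (j := j) hθ) (measure_mono fun W hW => ?_)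
  exact Function.mem_support.mpr (ne_of_gt (AlphaInputsT3AC.dataIntV3_low_pos_of_plaqSmall q π K j W hW))

/-- **`EnvelopeRegular` AT EVERY LEVEL `j ≤ K`**. [cite: Balaban1985UV3, (41) p.266 and (47) p.267] -/
theorem AlphaInputsT3AC.dataIntV3_envelopeRegular (K j : ℕ) (hj : j ≤ K) : EnvelopeRegular (AlphaInputsT3AC.dataIntV3 q π) K j :=
  ⟨AlphaInputsT3AC.dataIntV3_integrable_low q π K j hj, AlphaInputsT3AC.dataIntV3_integrable_up q π K j hj,
    AlphaInputsT3AC.dataIntV3_integral_low_pos q π K j hj⟩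


end Summit.QuantumFields.YangMills.Theorems

end
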